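import Literature.Combinatorics.Optimization.ShellLawLevelStep
import Literature.Combinatorics.StablePolynomials.RealRootedBernoulliSum
import Literature.Probability.Distributions.PoissonBinomialDifferences
import Literature.Combinatorics.Optimization.ShellLawEdgeProduct
import HarnessLib

/-!
# The generating polynomial of a shell law is a nonnegative combination of shifted hypergeometric
# generating polynomials; smoothness of the shell law from smoothness of its components

Continuation of `ShellLawLevelStep.lean` (§9 half-set decomposition, §10 three-type product) in
POLYNOMIAL currency. For a fixed-point-free involution `π` (a perfect matching), a `π`-stable ground
set `S` and a block `H`, the generating polynomial of the shell law of the block statistic,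
`G_S(t,c) = Σ_{U ∈ Shell_S(t,c)} X^{|U ∩ H|}` (so `G_S(t,c).coeff x = Sh_S(t,c;x)`, `coeff_shellGen`), is

* §2 (`shellGen_zero_eq_sum_hyperGen`) at level `0`:
  `G_S(2s,0) = Σ_{α ≤ s} C(a,α) · X^{2α} · H_{b,d,s−α}(X)`, where `(a,b,d)` are the numbers of `HH`,
  mixed and `H̄H̄` edges of `S` and `H_{b,d,r} = Σ_k C(b,k)C(d,r−k)X^k` is the hypergeometric
  generating polynomial (`StablePolynomials.hyperGen`): inside a fully matched cut the three edge
  types are drawn without replacement (tree `card_shellIn_zero_types`) and `|U ∩ H| = 2·#HH + #mixed`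
  (tree `card_inter_eq_of_level_zero`);
* §3 (`shellGen_eq_sum_halfSets`) at level `c ≤ t`:
  `G_S(t,c) = Σ_{Y ∈ halfSets(S,c)} X^{|Y∩H|} · G_{S∖(Y∪πY)}(t−c,0)` (tree `shellCount_eq_sum_halfSets`,
  coefficientwise);
* hence (§3 `shellGen_eq_sum_halfSets_hyperGen`, `card_shellIn_eq_sum_halfSets_types`) `G_S(c+2s,c)` is a
  NONNEGATIVE INTEGER COMBINATION OF SHIFTED HYPERGEOMETRIC GENERATING POLYNOMIALS
  `Σ_{Y,α} C(a_Y,α)·X^{|Y∩H|+2α}·H_{b_Y,d_Y,s−α}`, with total mass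
  `|Shell_S(c+2s,c)| = Σ_{Y,α} C(a_Y,α)·C(b_Y+d_Y,s−α)` (Vandermonde, `eval_one_hyperGen`);
* §4 (`sum_abs_coeff_shellGen_le`) the smoothness transfer: for every `j, N`,
  `Σ_{i<N} |((1−X)^j·G_S(c+2s,c)).coeff i| ≤ Σ_{Y,α} C(a_Y,α)·Σ_{i<N} |((1−X)^j·H_{b_Y,d_Y,s−α}).coeff i|`
  — the `ℓ¹`-norm of the `j`-th difference of a mixture is at most the mixture of the `ℓ¹`-norms
  (Röllin–Ross's `D_j(L(W)) ≤ E D_j(L(W | F))`, here with the shift invariance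
  `sum_abs_coeff_X_pow_mul_le` and the triangle inequality `sum_abs_coeff_sum_le`): the `x`-smoothness
  numbers `X_j(S,t,c) = ‖∇^j law_S(t,c;·)‖₁` are type-averages of hypergeometric (= Poisson-binomial,
  `RealRootedBernoulliSum.lean`) smoothness numbers.
* §5 (`nab2_iter_eq_coeff`, `sum_abs_nab2_iter_shellLaw_le`) the dictionary with the profile language of
  `ShellLawLevelStep` §6–§8 / `ShellLawSmoothing`: `(∇²)^m law_S(t,·)(c)` is `|Shell_S(t,c)|⁻¹` times the
  coefficient sequence of `(1−X)^{2m}·G_S(t,c)`, hence for every finite window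
  `Σ_{x∈win} |(∇²)^m law_S(c+2s,·)(c)(x)| ≤ |Shell|⁻¹·Σ_{Y,α} C(a_Y,α)·‖(1−X)^{2m}·H_{b_Y,d_Y,s−α}‖₁`
  (`‖R‖₁ = Σ_{i ≤ deg R}|R_i|`, the spelling of `PoissonBinomialDifferences`);
* §6 (`sum_abs_nab2_iter_shellLaw_le_threshold`) the THRESHOLD FORM obtained by feeding in the
  hypergeometric difference bounds of `PoissonBinomialDifferences` (`hypergeometric_absCoeffSum_le`,
  `…_le_two_pow`): for `V₀ > 0`, `2m − 1 ≤ 2V₀` and any set of typical types on which the component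
  variance `V_{Y,α} ≥ V₀`,
  `Σ_{x∈win} |(∇²)^m law_S(c+2s,·)(c)(x)| ≤ (2√192·√(4m/V₀))^{2m} + 4^m·μ(atypical types)`;
* §7 (`sum_abs_nab2_iter_shellLaw_le_tail`) the atypical mass as a hypergeometric tail in the number of
  `HH` edges drawn, `≤ C(s,k)C(a,k)/C(N′,k)`; §8 (`shellCount_eq_of_type_eq`, `card_shellIn_eq_of_type_eq`,
  `shellLaw_eq_of_type_eq`) the TRANSPORT: shell counts, sizes and laws depend on the ground set only
  through its `H`-type `(a,b,d)` (edge-product formula of `ShellLawEdgeProduct.lean`).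

All PROVED, 0 sorry, no definitions, no named facts. Cell pnp-psdrank (LIT-45 §2 (i), the mixture
layer of the `x`-smoothness link (c3) of LIT-44 §5): composes by multiplication with the
Poisson-binomial difference bounds `Σ_i |((1−X)^j·∏((1−p)+pX)).coeff i| ≤ (C√(j/V))^j`.

## References

* [Rothvoss2017] T. Rothvoß, *The matching polytope has exponential extension complexity*, J. ACM 64
  (2017), §2 (cuts `U`, the partition of a cut by a perfect matching; PDF pp. 5–6).
* [RollinRoss2010] A. Röllin, N. Ross, *Local limit theorems via Landau–Kolmogorov inequalities*,
  Bernoulli 21 (2015) 851–880 = arXiv:1011.3100, §3: the smoothness measure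
  `D_{n,m}(F) = m‖Δ^{n+1} F̄^m‖₁`, Lemma 3.3 (conditioning/mixtures), Lemma 3.4 (independent sums).
* [VatutinMikhailov1983] V. A. Vatutin, V. G. Mikhailov, Theory Probab. Appl. 27:4 (1983) 734–743, §2
  (the hypergeometric generating polynomial).
* [GodsilMeagher2015] C. Godsil, K. Meagher, *Erdős–Ko–Rado Theorems: Algebraic Approaches* (2015),
  §15.2 (perfect matchings as fixed-point-free involutions; edge representatives).
-/

noncomputable section

open Finset Polynomial

namespace Literature.Combinatorics.Optimization

namespace ShellStep

open Literature.Combinatorics.StablePolynomials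

variable {n : ℕ} {π : Fin n → Fin n}

/-! ### §1 The generating polynomial of a shell law; `ℓ¹` bookkeeping for coefficient sequences -/

/-- The coefficients of the shell generating polynomial `Σ_{U ∈ Shell_S(t,c)} X^{|U∩H|}` are the
shell counts `Sh_S(t,c;k)`. [cite: Rothvoss2017, §2 (PDF p. 6)] -/
theorem coeff_shellGen (S H : Finset (Fin n)) (t c k : ℕ) :
    (∑ U ∈ shellIn π S t c, (X : ℝ[X]) ^ (U ∩ H).card).coeff k = shellCount π S H t c (k : ℤ) := by
  rw [finsetSum_coeff, shellCount]
  simp only [coeff_X_pow]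
  rw [Finset.sum_boole]
  have hfilter : ((shellIn π S t c).filter fun U => k = (U ∩ H).card) =
      (shellIn π S t c).filter fun U => ((U ∩ H).card : ℤ) = k :=
    filter_congr fun U _ => by constructor <;> intro h <;> omega
  rw [hfilter]

/-- Shell counts vanish at negative arguments. [cite: Rothvoss2017, §2 (PDF p. 6)] -/
theorem shellCount_eq_zero_of_neg (S H : Finset (Fin n)) (t c : ℕ) {x : ℤ} (hx : x < 0) :
    shellCount π S H t c x = 0 := by
  rw [shellCount, Nat.cast_eq_zero, card_eq_zero, filter_eq_empty_iff]
  intro U _ h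
  omega

/-- The value of the shell generating polynomial at `1` is the shell size.
[cite: Rothvoss2017, §2 (PDF p. 6)] -/
theorem eval_one_shellGen (S H : Finset (Fin n)) (t c : ℕ) :
    (∑ U ∈ shellIn π S t c, (X : ℝ[X]) ^ (U ∩ H).card).eval 1 = ((shellIn π S t c).card : ℝ) := by
  rw [eval_finsetSum]
  simp

/-- Shift invariance of the coefficient `ℓ¹`-norm, one step: `Σ_{i<N} |(X·Q)_i| ≤ Σ_{i<N} |Q_i|`.
[cite: RollinRoss2010, §3 (definition of `D_{n,m}`)] -/
theorem sum_abs_coeff_X_mul_le (N : ℕ) (Q : ℝ[X]) :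
    ∑ i ∈ range N, |(X * Q).coeff i| ≤ ∑ i ∈ range N, |Q.coeff i| := by
  rcases N with _ | N
  · simp
  · rw [sum_range_succ', coeff_X_mul_zero, abs_zero, add_zero, sum_range_succ]
    simp only [coeff_X_mul]
    exact le_add_of_nonneg_right (abs_nonneg _)

/-- Shift invariance of the coefficient `ℓ¹`-norm: `Σ_{i<N} |(X^m·Q)_i| ≤ Σ_{i<N} |Q_i|`.
[cite: RollinRoss2010, §3 (definition of `D_{n,m}`)] -/
theorem sum_abs_coeff_X_pow_mul_le (m N : ℕ) (Q : ℝ[X]) :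
    ∑ i ∈ range N, |(X ^ m * Q).coeff i| ≤ ∑ i ∈ range N, |Q.coeff i| := by
  induction m with
  | zero => simp
  | succ m ih =>
    rw [pow_succ', mul_assoc]
    exact (sum_abs_coeff_X_mul_le N _).trans ih

/-- Triangle inequality for the coefficient `ℓ¹`-norm of a finite sum of polynomials (the smoothness
of a mixture is at most the mixture of the smoothnesses). [cite: RollinRoss2010, Lemma 3.3] -/
theorem sum_abs_coeff_sum_le {ι : Type*} (s : Finset ι) (P : ι → ℝ[X]) (N : ℕ) :
    ∑ i ∈ range N, |(∑ y ∈ s, P y).coeff i| ≤ ∑ y ∈ s, ∑ i ∈ range N, |(P y).coeff i| := by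
  rw [sum_comm]
  refine sum_le_sum fun i _ => ?_
  rw [finsetSum_coeff]
  exact abs_sum_le_sum_abs _ _

/-- Nonnegative scalars pull out of the coefficient `ℓ¹`-norm.
[cite: RollinRoss2010, §3 (definition of `D_{n,m}`)] -/
theorem sum_abs_coeff_C_mul (N : ℕ) {a : ℝ} (ha : 0 ≤ a) (Q : ℝ[X]) :
    ∑ i ∈ range N, |(C a * Q).coeff i| = a * ∑ i ∈ range N, |Q.coeff i| := by
  rw [mul_sum]
  refine sum_congr rfl fun i _ => ?_
  rw [coeff_C_mul, abs_mul, abs_of_nonneg ha]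

section GenPoly

variable (hπ : ∀ v, π (π v) = v) (hπ' : ∀ v, π v ≠ v)
include hπ hπ'

/-! ### §2 Level `0`: the generating polynomial is `Σ_α C(a,α) X^{2α} H_{b,d,s−α}` -/

/-- Per-cut bookkeeping at level `0`: for a fully matched cut `W ⊆ S` of size `2s`, with
`α = #HH edges` and `β = #mixed edges` inside `W` (`2α = |W ∩ AA|`, `2β = |W ∩ (BH ∪ BN)|`):
`|W ∩ H| = 2α + β` and `α + β ≤ s`. [cite: Rothvoss2017, §2 (PDF p. 6)] -/
theorem level_zero_bookkeeping {S : Finset (Fin n)} (hS : ∀ v ∈ S, π v ∈ S) (H : Finset (Fin n))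
    {s : ℕ} {W : Finset (Fin n)} (hW : W ∈ shellIn π S (2 * s) 0) :
    2 * (reps π (W ∩ vAA π S H)).card = (W ∩ vAA π S H).card ∧
      2 * (reps π (W ∩ (vBH π S H ∪ vBN π S H))).card = (W ∩ (vBH π S H ∪ vBN π S H)).card ∧
      (W ∩ H).card =
        2 * (reps π (W ∩ vAA π S H)).card + (reps π (W ∩ (vBH π S H ∪ vBN π S H))).card ∧
      (W ∩ vAA π S H).card + (W ∩ (vBH π S H ∪ vBN π S H)).card ≤ 2 * s := by
  obtain ⟨hWS, hWcard, hWst⟩ := mem_shellIn_zero.1 hW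
  have hAst : ∀ v ∈ W ∩ vAA π S H, π v ∈ W ∩ vAA π S H := by
    intro v hv
    rw [mem_inter] at hv ⊢
    exact ⟨hWst v hv.1, vAA_stable hπ S H hS v hv.2⟩
  have hBst : ∀ v ∈ W ∩ (vBH π S H ∪ vBN π S H), π v ∈ W ∩ (vBH π S H ∪ vBN π S H) := by
    intro v hv
    rw [mem_inter] at hv ⊢
    exact ⟨hWst v hv.1, vB_stable hπ S H hS v hv.2⟩
  have h1 := two_mul_card_reps hπ hπ' hAst
  have h2 := two_mul_card_reps hπ hπ' hBst
  obtain ⟨hx, hbb⟩ := card_inter_eq_of_level_zero hπ H hWS hWst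
  have hBsplit : (W ∩ (vBH π S H ∪ vBN π S H)).card =
      (W ∩ vBH π S H).card + (W ∩ vBN π S H).card := by
    rw [inter_union_distrib_left, card_union_of_disjoint]
    exact disjoint_left.2 fun v hv hv' =>
      (mem_vBN.1 (mem_inter.1 hv').2).2.1 (mem_vBH.1 (mem_inter.1 hv).2).2.1
  have hle : (W ∩ vAA π S H).card + (W ∩ (vBH π S H ∪ vBN π S H)).card ≤ 2 * s := by
    rw [← card_union_of_disjoint, ← hWcard]
    · exact card_le_card (union_subset inter_subset_left inter_subset_left)
    · exact disjoint_left.2 fun v hv hv' => by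
        have hA := mem_vAA.1 (mem_inter.1 hv).2
        rcases mem_union.1 (mem_inter.1 hv').2 with h | h
        · exact (mem_vBH.1 h).2.2 hA.2.2
        · exact (mem_vBN.1 h).2.1 hA.2.1
  refine ⟨h1, h2, ?_, hle⟩
  omega

/-- The size of the `(α, β)` type class of a level-`0` shell, in representative counts:
`#{W ∈ Shell_S(2s,0) : #HH(W) = α, #mixed(W) = β} = C(a,α)·C(b,β)·C(d,s−α−β)` for `α + β ≤ s`.
[cite: Rothvoss2017, §2 (PDF p. 6)] -/
theorem card_shellIn_zero_typeClass {S : Finset (Fin n)} (hS : ∀ v ∈ S, π v ∈ S) (H : Finset (Fin n))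
    {s α β : ℕ} (hαβ : α + β ≤ s) :
    ((shellIn π S (2 * s) 0).filter fun W => (reps π (W ∩ vAA π S H)).card = α ∧
        (reps π (W ∩ (vBH π S H ∪ vBN π S H))).card = β).card =
      (reps π (vAA π S H)).card.choose α * ((reps π (vBH π S H ∪ vBN π S H)).card.choose β *
        (reps π (vDD π S H)).card.choose (s - α - β)) := by
  have h2s : 2 * s = 2 * (α + β + (s - α - β)) := by omega
  rw [← card_shellIn_zero_types hπ hπ' hS H α β (s - α - β), ← h2s]
  congr 1
  refine filter_congr fun W hW => ?_
  have h := level_zero_bookkeeping hπ hπ' hS H hW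
  constructor
  · rintro ⟨h1, h2⟩; constructor <;> omega
  · rintro ⟨h1, h2⟩; constructor <;> omega

/-- **Level `0`: the shell generating polynomial is a binomial mixture of shifted hypergeometric
generating polynomials**: for a `π`-stable ground set `S` with `a` edges of type `HH`, `b` mixed edges
and `d` edges of type `H̄H̄`,
`Σ_{W ∈ Shell_S(2s,0)} X^{|W∩H|} = Σ_{α ≤ s} C(a,α) · X^{2α} · Σ_β C(b,β) C(d,s−α−β) X^β`.
[cite: Rothvoss2017, §2 (PDF p. 6)] [cite: VatutinMikhailov1983, §2] -/
theorem shellGen_zero_eq_sum_hyperGen {S : Finset (Fin n)} (hS : ∀ v ∈ S, π v ∈ S)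
    (H : Finset (Fin n)) (s : ℕ) :
    ∑ W ∈ shellIn π S (2 * s) 0, (X : ℝ[X]) ^ (W ∩ H).card =
      ∑ α ∈ range (s + 1), C (((reps π (vAA π S H)).card.choose α : ℕ) : ℝ) * X ^ (2 * α) *
        hyperGen (reps π (vBH π S H ∪ vBN π S H)).card (reps π (vDD π S H)).card (s - α) := by
  -- fibre by `α`, then by `β`
  rw [← sum_fiberwise_of_maps_to (s := shellIn π S (2 * s) 0) (t := range (s + 1))
    (g := fun W => (reps π (W ∩ vAA π S H)).card) (fun W hW => by
      have h := level_zero_bookkeeping hπ hπ' hS H hW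
      rw [mem_range]
      omega)]
  refine sum_congr rfl fun α hα => ?_
  have hαs : α ≤ s := Nat.lt_succ_iff.1 (mem_range.1 hα)
  rw [← sum_fiberwise_of_maps_to
    (s := (shellIn π S (2 * s) 0).filter fun W => (reps π (W ∩ vAA π S H)).card = α)
    (t := range (s - α + 1)) (g := fun W => (reps π (W ∩ (vBH π S H ∪ vBN π S H))).card)
    (fun W hW => by
      rw [mem_filter] at hW
      have h := level_zero_bookkeeping hπ hπ' hS H hW.1
      rw [mem_range]
      omega)]
  rw [hyperGen, mul_sum]
  refine sum_congr rfl fun β hβ => ?_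
  have hβs : β ≤ s - α := Nat.lt_succ_iff.1 (mem_range.1 hβ)
  rw [filter_filter]
  have hfib : ∀ W ∈ (shellIn π S (2 * s) 0).filter (fun W => (reps π (W ∩ vAA π S H)).card = α ∧
      (reps π (W ∩ (vBH π S H ∪ vBN π S H))).card = β),
      (X : ℝ[X]) ^ (W ∩ H).card = X ^ (2 * α + β) := by
    intro W hW
    rw [mem_filter] at hW
    obtain ⟨hW, hWα, hWβ⟩ := hW
    rw [(level_zero_bookkeeping hπ hπ' hS H hW).2.2.1, hWα, hWβ]
  rw [sum_congr rfl hfib, sum_const, card_shellIn_zero_typeClass hπ hπ' hS H (by omega), nsmul_eq_mul]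
  push_cast
  simp only [map_mul, map_natCast]
  ring

/-! ### §3 Level `c`: the half-set layer, and the full decomposition -/

omit hπ' in
/-- **The half-set decomposition in polynomial form**: for `c ≤ t`,
`Σ_{U ∈ Shell_S(t,c)} X^{|U∩H|} = Σ_{Y ∈ halfSets(S,c)} X^{|Y∩H|} · Σ_{W ∈ Shell_{S∖(Y∪πY)}(t−c,0)} X^{|W∩H|}`
(coefficientwise this is `shellCount_eq_sum_halfSets`). [cite: Rothvoss2017, §2 (PDF p. 6)] -/
theorem shellGen_eq_sum_halfSets {S : Finset (Fin n)} (H : Finset (Fin n)) {t c : ℕ} (hct : c ≤ t) :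
    ∑ U ∈ shellIn π S t c, (X : ℝ[X]) ^ (U ∩ H).card =
      ∑ Y ∈ halfSets π S c, X ^ (Y ∩ H).card *
        ∑ W ∈ shellIn π (strip π S Y) (t - c) 0, (X : ℝ[X]) ^ (W ∩ H).card := by
  ext k
  rw [coeff_shellGen, shellCount_eq_sum_halfSets hπ H hct, finsetSum_coeff]
  refine sum_congr rfl fun Y _ => ?_
  rw [coeff_X_pow_mul']
  split_ifs with h
  · rw [coeff_shellGen]
    congr 1
    omega
  · exact shellCount_eq_zero_of_neg _ _ _ _ (by omega)

/-- **The shell generating polynomial is a nonnegative integer combination of shifted hypergeometric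
generating polynomials**:
`Σ_{U ∈ Shell_S(c+2s,c)} X^{|U∩H|} = Σ_{Y ∈ halfSets(S,c)} Σ_{α ≤ s} C(a_Y,α) · X^{|Y∩H|+2α} · H_{b_Y,d_Y,s−α}`,
`(a_Y,b_Y,d_Y)` the edge-type counts of the stripped ground set `S ∖ (Y ∪ πY)`.
[cite: Rothvoss2017, §2 (PDF p. 6)] [cite: VatutinMikhailov1983, §2] -/
theorem shellGen_eq_sum_halfSets_hyperGen {S : Finset (Fin n)} (hS : ∀ v ∈ S, π v ∈ S)
    (H : Finset (Fin n)) (c s : ℕ) :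
    ∑ U ∈ shellIn π S (c + 2 * s) c, (X : ℝ[X]) ^ (U ∩ H).card =
      ∑ Y ∈ halfSets π S c, ∑ α ∈ range (s + 1),
        C (((reps π (vAA π (strip π S Y) H)).card.choose α : ℕ) : ℝ) * X ^ ((Y ∩ H).card + 2 * α) *
          hyperGen (reps π (vBH π (strip π S Y) H ∪ vBN π (strip π S Y) H)).card
            (reps π (vDD π (strip π S Y) H)).card (s - α) := by
  rw [shellGen_eq_sum_halfSets hπ H (by omega : c ≤ c + 2 * s), Nat.add_sub_cancel_left]
  refine sum_congr rfl fun Y _ => ?_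
  rw [shellGen_zero_eq_sum_hyperGen hπ hπ' (strip_stable hπ hS) H s, mul_sum]
  refine sum_congr rfl fun α _ => ?_
  rw [pow_add]
  ring

/-- **Total mass**: `|Shell_S(c+2s,c)| = Σ_{Y ∈ halfSets(S,c)} Σ_{α ≤ s} C(a_Y,α) · C(b_Y+d_Y, s−α)`
(the decomposition evaluated at `X = 1`, Vandermonde). [cite: Rothvoss2017, §2 (PDF p. 6)] -/
theorem card_shellIn_eq_sum_halfSets_types {S : Finset (Fin n)} (hS : ∀ v ∈ S, π v ∈ S)
    (H : Finset (Fin n)) (c s : ℕ) :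
    ((shellIn π S (c + 2 * s) c).card : ℝ) =
      ∑ Y ∈ halfSets π S c, ∑ α ∈ range (s + 1),
        (((reps π (vAA π (strip π S Y) H)).card.choose α : ℕ) : ℝ) *
          (((reps π (vBH π (strip π S Y) H ∪ vBN π (strip π S Y) H)).card +
              (reps π (vDD π (strip π S Y) H)).card).choose (s - α) : ℕ) := by
  rw [← eval_one_shellGen S H, shellGen_eq_sum_halfSets_hyperGen hπ hπ' hS H c s, eval_finsetSum]
  refine sum_congr rfl fun Y _ => ?_
  rw [eval_finsetSum]
  refine sum_congr rfl fun α _ => ?_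
  rw [eval_mul, eval_mul, eval_C, eval_pow, eval_X, one_pow, mul_one, eval_one_hyperGen]

/-! ### §4 The smoothness transfer: `ℓ¹`-norms of differences of the shell law are bounded by the
type-average of those of the hypergeometric components -/

/-- **Smoothness of a shell law from smoothness of its hypergeometric components**: for every order `j`
and every truncation `N`,
`Σ_{i<N} |((1−X)^j · Σ_{U ∈ Shell_S(c+2s,c)} X^{|U∩H|}).coeff i|
   ≤ Σ_{Y ∈ halfSets(S,c)} Σ_{α ≤ s} C(a_Y,α) · Σ_{i<N} |((1−X)^j · H_{b_Y,d_Y,s−α}).coeff i|`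
— dividing by `|Shell_S(c+2s,c)| = Σ_{Y,α} C(a_Y,α)C(b_Y+d_Y,s−α)` (`card_shellIn_eq_sum_halfSets_types`),
the `ℓ¹`-norm of the `j`-th difference of the shell law is at most the `(Y,α)`-average of the `ℓ¹`-norms of
the `j`-th differences of the hypergeometric laws `H_{b_Y,d_Y,s−α}/C(b_Y+d_Y,s−α)` (Röllin–Ross: the
smoothness of a mixture is at most the mean smoothness of its components; shifts do not matter).
[cite: RollinRoss2010, Lemma 3.3] [cite: Rothvoss2017, §2 (PDF p. 6)] -/
theorem sum_abs_coeff_shellGen_le {S : Finset (Fin n)} (hS : ∀ v ∈ S, π v ∈ S) (H : Finset (Fin n))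
    (c s j N : ℕ) :
    ∑ i ∈ range N, |((1 - X) ^ j * ∑ U ∈ shellIn π S (c + 2 * s) c, (X : ℝ[X]) ^ (U ∩ H).card).coeff i| ≤
      ∑ Y ∈ halfSets π S c, ∑ α ∈ range (s + 1),
        (((reps π (vAA π (strip π S Y) H)).card.choose α : ℕ) : ℝ) *
          ∑ i ∈ range N, |((1 - X) ^ j *
            hyperGen (reps π (vBH π (strip π S Y) H ∪ vBN π (strip π S Y) H)).card
              (reps π (vDD π (strip π S Y) H)).card (s - α)).coeff i| := by
  have hexp : (1 - X) ^ j * ∑ U ∈ shellIn π S (c + 2 * s) c, (X : ℝ[X]) ^ (U ∩ H).card =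
      ∑ Y ∈ halfSets π S c, ∑ α ∈ range (s + 1),
        C (((reps π (vAA π (strip π S Y) H)).card.choose α : ℕ) : ℝ) *
          (X ^ ((Y ∩ H).card + 2 * α) * ((1 - X) ^ j *
            hyperGen (reps π (vBH π (strip π S Y) H ∪ vBN π (strip π S Y) H)).card
              (reps π (vDD π (strip π S Y) H)).card (s - α))) := by
    rw [shellGen_eq_sum_halfSets_hyperGen hπ hπ' hS H c s, mul_sum]
    refine sum_congr rfl fun Y _ => ?_
    rw [mul_sum]
    refine sum_congr rfl fun α _ => ?_
    ring
  rw [hexp]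
  refine (sum_abs_coeff_sum_le _ _ N).trans (sum_le_sum fun Y _ => ?_)
  refine (sum_abs_coeff_sum_le _ _ N).trans (sum_le_sum fun α _ => ?_)
  rw [sum_abs_coeff_C_mul N (Nat.cast_nonneg _)]
  exact mul_le_mul_of_nonneg_left (sum_abs_coeff_X_pow_mul_le _ N _) (Nat.cast_nonneg _)

/-! ### §5 The dictionary with the profile language of `ShellLawLevelStep` §6–§8: iterated second
`x`-differences of the shell LAW are the coefficients of `(1−X)^{2m} · G_S(t,c)` over `|Shell_S(t,c)|` -/

omit hπ hπ' in
/-- `((1−X)²·R)_0 = R_0`. [folklore] -/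
private theorem coeff_oneSubX_sq_mul_zero (R : ℝ[X]) : ((1 - X) ^ 2 * R).coeff 0 = R.coeff 0 := by
  have h : (1 - X : ℝ[X]) ^ 2 * R = R - X * R - X * R + X * (X * R) := by ring
  rw [h, coeff_add, coeff_sub, coeff_sub, coeff_X_mul_zero, coeff_X_mul_zero]
  ring

omit hπ hπ' in
/-- `((1−X)²·R)_1 = R_1 − 2R_0`. [folklore] -/
private theorem coeff_oneSubX_sq_mul_one (R : ℝ[X]) :
    ((1 - X) ^ 2 * R).coeff 1 = R.coeff 1 - 2 * R.coeff 0 := by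
  have h : (1 - X : ℝ[X]) ^ 2 * R = R - X * R - X * R + X * (X * R) := by ring
  rw [h, coeff_add, coeff_sub, coeff_sub, coeff_X_mul, coeff_X_mul, coeff_X_mul_zero]
  ring

omit hπ hπ' in
/-- `((1−X)²·R)_{i+2} = R_{i+2} − 2R_{i+1} + R_i`. [folklore] -/
private theorem coeff_oneSubX_sq_mul_add_two (R : ℝ[X]) (i : ℕ) :
    ((1 - X) ^ 2 * R).coeff (i + 2) = R.coeff (i + 2) - 2 * R.coeff (i + 1) + R.coeff i := by
  have h : (1 - X : ℝ[X]) ^ 2 * R = R - X * R - X * R + X * (X * R) := by ring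
  rw [h, coeff_add, coeff_sub, coeff_sub, coeff_X_mul, coeff_X_mul, coeff_X_mul]
  ring

omit hπ hπ' in
/-- **Dictionary.** If a profile is, level by level, `κ_c` times the coefficient sequence of a polynomial
`G_c` (and zero at negative arguments), then its `m`-fold second `x`-difference `(∇²)^m` is `κ_c` times
the coefficient sequence of `(1−X)^{2m}·G_c` (and zero at negative arguments): backward differences of
a sequence are multiplication of its generating polynomial by `1 − X`.
[cite: RollinRoss2010, §3 (the difference operators `Δ^n_m`)] -/
theorem nab2_iter_eq_coeff (P : Profile) (G : ℕ → ℝ[X]) (κ : ℕ → ℝ)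
    (hP : ∀ (c i : ℕ), P c i = κ c * (G c).coeff i) (hP' : ∀ (c : ℕ) (x : ℤ), x < 0 → P c x = 0)
    (m c : ℕ) :
    (∀ i : ℕ, nab2^[m] P c i = κ c * ((1 - X) ^ (2 * m) * G c).coeff i) ∧
      ∀ x : ℤ, x < 0 → nab2^[m] P c x = 0 := by
  induction m with
  | zero => simpa using ⟨hP c, hP' c⟩
  | succ m ih =>
    obtain ⟨ih1, ih2⟩ := ih
    have hpow : (1 - X : ℝ[X]) ^ (2 * (m + 1)) * G c = (1 - X) ^ 2 * ((1 - X) ^ (2 * m) * G c) := by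
      rw [show 2 * (m + 1) = 2 * m + 2 by ring, pow_add]
      ring
    constructor
    · intro i
      rw [Function.iterate_succ_apply', nab2, hpow]
      rcases i with _ | _ | i
      · rw [coeff_oneSubX_sq_mul_zero, ih1 0, ih2 (((0 : ℕ) : ℤ) - 1) (by omega),
          ih2 (((0 : ℕ) : ℤ) - 2) (by omega)]
        ring
      · rw [coeff_oneSubX_sq_mul_one, show (((0 + 1 : ℕ) : ℤ)) - 1 = ((0 : ℕ) : ℤ) by omega,
          ih1, ih1 0, ih2 (((0 + 1 : ℕ) : ℤ) - 2) (by omega)]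
        ring
      · rw [coeff_oneSubX_sq_mul_add_two,
          show (((i + 1 + 1 : ℕ) : ℤ)) - 1 = ((i + 1 : ℕ) : ℤ) by omega,
          show (((i + 1 + 1 : ℕ) : ℤ)) - 2 = ((i : ℕ) : ℤ) by omega, ih1, ih1, ih1]
        ring
    · intro x hx
      rw [Function.iterate_succ_apply', nab2, ih2 x hx, ih2 (x - 1) (by omega),
        ih2 (x - 2) (by omega)]
      ring

omit hπ hπ' in
/-- The shell law in dictionary form: `law_S(t,c;i) = |Shell_S(t,c)|⁻¹ · (G_S(t,c))_i` for `i ∈ ℕ`, and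
`law_S(t,c;x) = 0` for `x < 0`. [cite: Rothvoss2017, §2 (PDF p. 6)] -/
theorem shellLaw_eq_coeff (S H : Finset (Fin n)) (t c : ℕ) :
    (∀ i : ℕ, shellLaw π S H t c i =
      (1 / ((shellIn π S t c).card : ℝ)) * (∑ U ∈ shellIn π S t c, (X : ℝ[X]) ^ (U ∩ H).card).coeff i) ∧
      ∀ x : ℤ, x < 0 → shellLaw π S H t c x = 0 := by
  refine ⟨fun i => ?_, fun x hx => ?_⟩
  · rw [coeff_shellGen, shellLaw, one_div, inv_mul_eq_div]
  · rw [shellLaw, shellCount_eq_zero_of_neg S H t c hx, zero_div]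

omit hπ hπ' in
/-- Truncated coefficient `ℓ¹`-norms are dominated by the full one
`‖R‖₁ = Σ_{i ≤ deg R} |R_i|`. [cite: RollinRoss2010, §3 (definition of `D_{n,m}`)] -/
theorem sum_range_abs_coeff_le (R : ℝ[X]) (N : ℕ) :
    ∑ i ∈ range N, |R.coeff i| ≤ ∑ i ∈ range (R.natDegree + 1), |R.coeff i| := by
  have h1 : ∑ i ∈ range N, |R.coeff i| = ∑ i ∈ (range N).filter (fun i => i ≤ R.natDegree), |R.coeff i| := by
    rw [sum_filter]
    refine sum_congr rfl fun i _ => ?_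
    split_ifs with h
    · rfl
    · rw [coeff_eq_zero_of_natDegree_lt (by omega), abs_zero]
  rw [h1]
  refine sum_le_sum_of_subset_of_nonneg (fun i hi => ?_) (fun i _ _ => abs_nonneg _)
  rw [mem_filter] at hi
  rw [mem_range]
  omega

/-- **The `x`-smoothness numbers of a shell law are type-averages of hypergeometric ones.** For a
`π`-stable ground set `S`, a block `H`, a level `c`, `s` full edges (`t = c + 2s`), every `m` and every
finite window `win ⊆ ℤ`:
`Σ_{x ∈ win} |(∇²)^m law_S(t,·)(c)(x)| ≤ |Shell_S(t,c)|⁻¹ · Σ_{Y ∈ halfSets(S,c)} Σ_{α ≤ s} C(a_Y,α) · ‖(1−X)^{2m} · H_{b_Y,d_Y,s−α}‖₁`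
(`‖R‖₁ = Σ_{i ≤ deg R} |R_i|`; the left side is hypothesis (ii) of `ShellLawSmoothing`'s iterated bound,
the right side is bounded term by term by the Poisson-binomial difference estimates of
`PoissonBinomialDifferences`, and `Σ_{Y,α} C(a_Y,α)C(b_Y+d_Y,s−α) = |Shell_S(t,c)|`).
[cite: RollinRoss2010, Lemma 3.3] [cite: Rothvoss2017, §2 (PDF p. 6)] -/
theorem sum_abs_nab2_iter_shellLaw_le {S : Finset (Fin n)} (hS : ∀ v ∈ S, π v ∈ S) (H : Finset (Fin n))
    (c s m : ℕ) (win : Finset ℤ) :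
    ∑ x ∈ win, |nab2^[m] (fun c' x => shellLaw π S H (c + 2 * s) c' x : Profile) c x| ≤
      (1 / ((shellIn π S (c + 2 * s) c).card : ℝ)) *
        ∑ Y ∈ halfSets π S c, ∑ α ∈ range (s + 1),
          (((reps π (vAA π (strip π S Y) H)).card.choose α : ℕ) : ℝ) *
            ∑ i ∈ range (((1 - X) ^ (2 * m) *
                hyperGen (reps π (vBH π (strip π S Y) H ∪ vBN π (strip π S Y) H)).card
                  (reps π (vDD π (strip π S Y) H)).card (s - α)).natDegree + 1),
              |((1 - X) ^ (2 * m) *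
                hyperGen (reps π (vBH π (strip π S Y) H ∪ vBN π (strip π S Y) H)).card
                  (reps π (vDD π (strip π S Y) H)).card (s - α)).coeff i| := by
  -- the dictionary
  obtain ⟨hd1, hd2⟩ := nab2_iter_eq_coeff (fun c' x => shellLaw π S H (c + 2 * s) c' x : Profile)
    (fun c' => ∑ U ∈ shellIn π S (c + 2 * s) c', (X : ℝ[X]) ^ (U ∩ H).card)
    (fun c' => 1 / ((shellIn π S (c + 2 * s) c').card : ℝ))
    (fun c' i => (shellLaw_eq_coeff S H (c + 2 * s) c').1 i)
    (fun c' x hx => (shellLaw_eq_coeff S H (c + 2 * s) c').2 x hx) m c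
  have hκ : 0 ≤ 1 / ((shellIn π S (c + 2 * s) c).card : ℝ) := by positivity
  -- drop the negative window, reindex the nonnegative part by `Int.toNat`
  set R : ℝ[X] := (1 - X) ^ (2 * m) * ∑ U ∈ shellIn π S (c + 2 * s) c, (X : ℝ[X]) ^ (U ∩ H).card
    with hR
  have hterm : ∀ x ∈ win, |nab2^[m] (fun c' x => shellLaw π S H (c + 2 * s) c' x : Profile) c x| =
      if 0 ≤ x then (1 / ((shellIn π S (c + 2 * s) c).card : ℝ)) * |R.coeff x.toNat| else 0 := by
    intro x _
    split_ifs with hx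
    · have hx' : ((x.toNat : ℕ) : ℤ) = x := Int.toNat_of_nonneg hx
      conv_lhs => rw [← hx']
      rw [hd1, abs_mul, abs_of_nonneg hκ]
    · rw [hd2 x (by omega), abs_zero]
  rw [sum_congr rfl hterm, ← sum_filter, ← mul_sum]
  refine mul_le_mul_of_nonneg_left ?_ hκ
  -- `Σ_{x ∈ win, x ≥ 0} |R_{x.toNat}| ≤ Σ_{i < N} |R_i|` with `N` past the window
  set N : ℕ := (win.filter fun x => 0 ≤ x).sup Int.toNat + 1 with hN
  have hinj : Set.InjOn Int.toNat ↑(win.filter fun x : ℤ => 0 ≤ x) := by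
    intro x hx y hy hxy
    rw [coe_filter] at hx hy
    have := Int.toNat_of_nonneg hx.2
    have := Int.toNat_of_nonneg hy.2
    omega
  have hle : ∑ x ∈ win.filter (fun x => 0 ≤ x), |R.coeff x.toNat| ≤ ∑ i ∈ range N, |R.coeff i| := by
    rw [← sum_image (f := fun i => |R.coeff i|) hinj]
    refine sum_le_sum_of_subset_of_nonneg (fun i hi => ?_) (fun i _ _ => abs_nonneg _)
    rw [mem_image] at hi
    obtain ⟨x, hx, rfl⟩ := hi
    rw [mem_range, hN, Nat.lt_succ_iff]
    exact le_sup (f := Int.toNat) hx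
  refine hle.trans ?_
  -- the mixture bound, then saturate each truncated norm
  refine (sum_abs_coeff_shellGen_le hπ hπ' hS H c s (2 * m) N).trans ?_
  refine sum_le_sum fun Y _ => sum_le_sum fun α _ => ?_
  exact mul_le_mul_of_nonneg_left (sum_range_abs_coeff_le _ N) (Nat.cast_nonneg _)

/-! ### §6 The threshold form: Gaussian-grade smoothness at variance `V₀` plus `4^m` times the
exceptional type mass (the `(c3) + (e4)` interface of the per-matching chain) -/

omit hπ hπ' in
/-- The hypergeometric generating polynomial vanishes when more items are drawn than exist.
[cite: VatutinMikhailov1983, §2] -/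
theorem hyperGen_eq_zero_of_lt {b d r : ℕ} (h : b + d < r) : hyperGen b d r = 0 := by
  ext k
  rw [coeff_hyperGen, coeff_zero]
  split_ifs with hk
  · rcases Nat.lt_or_ge b k with hb | hb
    · rw [Nat.choose_eq_zero_of_lt hb, zero_mul, Nat.cast_zero]
    · rw [Nat.choose_eq_zero_of_lt (by omega : d < r - k), mul_zero, Nat.cast_zero]
  · rfl

omit hπ hπ' in
/-- Positivity of the hypergeometric variance forces `r ≤ b + d`. [cite: LehmannRomano2005, Example 3.4.1] -/
theorem le_add_of_hypVar_pos {b d r : ℕ}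
    (hV : 0 < (r : ℝ) * b * d * ((b : ℝ) + d - r) / (((b : ℝ) + d) ^ 2 * ((b : ℝ) + d - 1))) :
    r ≤ b + d := by
  by_contra h
  rw [not_le] at h
  have hlt : (b : ℝ) + d < r := by exact_mod_cast h
  have hnum : (r : ℝ) * b * d * ((b : ℝ) + d - r) ≤ 0 :=
    mul_nonpos_of_nonneg_of_nonpos (by positivity) (by linarith)
  rcases Nat.eq_zero_or_pos (b + d) with h0 | hpos
  · have hb : b = 0 := by omega
    have hd : d = 0 := by omega
    subst hb; subst hd
    simp at hV
  · have h1 : (1 : ℝ) ≤ (b : ℝ) + d := by exact_mod_cast hpos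
    have hden : 0 ≤ ((b : ℝ) + d) ^ 2 * ((b : ℝ) + d - 1) := mul_nonneg (by positivity) (by linarith)
    exact absurd hV (not_lt.2 (div_nonpos_of_nonpos_of_nonneg hnum hden))

omit hπ hπ' in
/-- **One hypergeometric component above the variance threshold**: with
`V = r b d (b+d−r)/((b+d)²(b+d−1))` the variance of `H_{b,d,r}/C(b+d,r)`, if `0 < V₀ ≤ V` and
`2m − 1 ≤ 2V₀` then `‖(1−X)^{2m} H_{b,d,r}‖₁ ≤ C(b+d,r) · (2√192·√(4m/V₀))^{2m}`.
[cite: RollinRoss2010, §3 (Lemma 3.4, Thm 4.2)] [cite: VatutinMikhailov1983, §2] -/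
theorem hypergeometric_absCoeffSum_le_of_le (b d r m : ℕ) {V₀ : ℝ} (hV₀ : 0 < V₀)
    (hm : (2 * m : ℝ) - 1 ≤ 2 * V₀)
    (hV : V₀ ≤ (r : ℝ) * b * d * ((b : ℝ) + d - r) / (((b : ℝ) + d) ^ 2 * ((b : ℝ) + d - 1))) :
    ∑ i ∈ range (((1 - X) ^ (2 * m) * hyperGen b d r).natDegree + 1),
        |((1 - X) ^ (2 * m) * hyperGen b d r).coeff i| ≤
      ((b + d).choose r : ℝ) * (2 * Real.sqrt 192 * Real.sqrt (4 * m / V₀)) ^ (2 * m) := by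
  have hVpos : 0 < (r : ℝ) * b * d * ((b : ℝ) + d - r) / (((b : ℝ) + d) ^ 2 * ((b : ℝ) + d - 1)) :=
    hV₀.trans_le hV
  have hr : r ≤ b + d := le_add_of_hypVar_pos hVpos
  have hj : ((2 * m : ℕ) : ℝ) - 1 ≤
      2 * ((r : ℝ) * b * d * ((b : ℝ) + d - r) / (((b : ℝ) + d) ^ 2 * ((b : ℝ) + d - 1))) := by
    push_cast; linarith
  refine (Literature.Probability.Distributions.PoissonBinomial.hypergeometric_absCoeffSum_le hr hVpos
    hj).trans ?_
  refine mul_le_mul_of_nonneg_left ?_ (by positivity)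
  refine pow_le_pow_left₀ (by positivity) ?_ _
  refine mul_le_mul_of_nonneg_left ?_ (by positivity)
  refine Real.sqrt_le_sqrt ?_
  rw [show (2 : ℝ) * ((2 * m : ℕ) : ℝ) = 4 * m by push_cast; ring]
  exact div_le_div_of_nonneg_left (by positivity) hV₀ hV

omit hπ hπ' in
/-- **One hypergeometric component, trivial bound**: `‖(1−X)^{2m} H_{b,d,r}‖₁ ≤ C(b+d,r) · 4^m` (all
`b, d, r`). [cite: RollinRoss2010, §3 (Lemma 3.4)] [cite: VatutinMikhailov1983, §2] -/
theorem hypergeometric_absCoeffSum_le_four_pow (b d r m : ℕ) :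
    ∑ i ∈ range (((1 - X) ^ (2 * m) * hyperGen b d r).natDegree + 1),
        |((1 - X) ^ (2 * m) * hyperGen b d r).coeff i| ≤ ((b + d).choose r : ℝ) * (4 : ℝ) ^ m := by
  rcases Nat.lt_or_ge (b + d) r with hr | hr
  · rw [hyperGen_eq_zero_of_lt hr, mul_zero]
    simp only [natDegree_zero, zero_add, coeff_zero, abs_zero, sum_const_zero]
    positivity
  · refine (Literature.Probability.Distributions.PoissonBinomial.hypergeometric_absCoeffSum_le_two_pow
      hr (2 * m)).trans (le_of_eq ?_)
    rw [pow_mul, show (2 : ℝ) ^ 2 = 4 by norm_num]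

/-- **The `x`-smoothness of a shell law, threshold form.** For a `π`-stable ground set `S`, block `H`,
level `c`, `s` full edges, every `m`, every finite window, every `V₀ > 0` with `2m − 1 ≤ 2V₀`, and every
(decidable) set `typ` of TYPICAL types `(Y, α)` — half-set `Y`, number `α` of `HH` edges — on which the
hypergeometric component (`s − α` draws from the `b_Y` mixed and `d_Y` `H̄H̄` edges of `S ∖ (Y ∪ πY)`) has
variance `V_{Y,α} = (s−α) b_Y d_Y (b_Y+d_Y−(s−α))/((b_Y+d_Y)²(b_Y+d_Y−1)) ≥ V₀`:
`Σ_{x ∈ win} |(∇²)^m law_S(c+2s,·)(c)(x)| ≤ (2√192·√(4m/V₀))^{2m} + 4^m · μ(atypical)`,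
`μ(atypical) = |Shell_S(c+2s,c)|⁻¹ · Σ_{(Y,α) ∉ typ} C(a_Y,α)·C(b_Y+d_Y,s−α)` the mass of the atypical
types (`card_shellIn_eq_sum_halfSets_types`): Gaussian-grade smoothness on the typical types, the
trivial bound `4^m` on the exceptional ones. [cite: RollinRoss2010, Lemma 3.3] [cite: Rothvoss2017, §2 (PDF p. 6)] -/
theorem sum_abs_nab2_iter_shellLaw_le_threshold {S : Finset (Fin n)} (hS : ∀ v ∈ S, π v ∈ S)
    (H : Finset (Fin n)) (c s m : ℕ) (win : Finset ℤ) {V₀ : ℝ} (hV₀ : 0 < V₀)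
    (hm : (2 * m : ℝ) - 1 ≤ 2 * V₀) (typ : Finset (Fin n) → ℕ → Prop) [∀ Y α, Decidable (typ Y α)]
    (htyp : ∀ Y ∈ halfSets π S c, ∀ α ∈ range (s + 1), typ Y α →
      V₀ ≤ ((s - α : ℕ) : ℝ) * (reps π (vBH π (strip π S Y) H ∪ vBN π (strip π S Y) H)).card *
          (reps π (vDD π (strip π S Y) H)).card *
          (((reps π (vBH π (strip π S Y) H ∪ vBN π (strip π S Y) H)).card : ℝ) +
            (reps π (vDD π (strip π S Y) H)).card - ((s - α : ℕ) : ℝ)) /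
        ((((reps π (vBH π (strip π S Y) H ∪ vBN π (strip π S Y) H)).card : ℝ) +
            (reps π (vDD π (strip π S Y) H)).card) ^ 2 *
          (((reps π (vBH π (strip π S Y) H ∪ vBN π (strip π S Y) H)).card : ℝ) +
            (reps π (vDD π (strip π S Y) H)).card - 1))) :
    ∑ x ∈ win, |nab2^[m] (fun c' x => shellLaw π S H (c + 2 * s) c' x : Profile) c x| ≤
      (2 * Real.sqrt 192 * Real.sqrt (4 * m / V₀)) ^ (2 * m) +
        (4 : ℝ) ^ m * ((1 / ((shellIn π S (c + 2 * s) c).card : ℝ)) *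
          ∑ Y ∈ halfSets π S c, ∑ α ∈ range (s + 1),
            if typ Y α then 0 else
              (((reps π (vAA π (strip π S Y) H)).card.choose α : ℕ) : ℝ) *
                ((((reps π (vBH π (strip π S Y) H ∪ vBN π (strip π S Y) H)).card +
                  (reps π (vDD π (strip π S Y) H)).card).choose (s - α) : ℕ) : ℝ)) := by
  refine (sum_abs_nab2_iter_shellLaw_le hπ hπ' hS H c s m win).trans ?_
  have hκ : 0 ≤ 1 / ((shellIn π S (c + 2 * s) c).card : ℝ) := by positivity
  have hB : 0 ≤ (2 * Real.sqrt 192 * Real.sqrt (4 * m / V₀)) ^ (2 * m) := by positivity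
  -- termwise: `C(a,α)·‖…‖₁ ≤ C(a,α)·C(b+d,r)·B₀ + 4^m·(atypical weight)`
  have hterm : ∀ Y ∈ halfSets π S c, ∀ α ∈ range (s + 1),
      (((reps π (vAA π (strip π S Y) H)).card.choose α : ℕ) : ℝ) *
          ∑ i ∈ range (((1 - X) ^ (2 * m) *
              hyperGen (reps π (vBH π (strip π S Y) H ∪ vBN π (strip π S Y) H)).card
                (reps π (vDD π (strip π S Y) H)).card (s - α)).natDegree + 1),
            |((1 - X) ^ (2 * m) *
              hyperGen (reps π (vBH π (strip π S Y) H ∪ vBN π (strip π S Y) H)).card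
                (reps π (vDD π (strip π S Y) H)).card (s - α)).coeff i| ≤
        (((reps π (vAA π (strip π S Y) H)).card.choose α : ℕ) : ℝ) *
            ((((reps π (vBH π (strip π S Y) H ∪ vBN π (strip π S Y) H)).card +
              (reps π (vDD π (strip π S Y) H)).card).choose (s - α) : ℕ) : ℝ) *
            (2 * Real.sqrt 192 * Real.sqrt (4 * m / V₀)) ^ (2 * m) +
          (4 : ℝ) ^ m *
            (if typ Y α then 0 else
              (((reps π (vAA π (strip π S Y) H)).card.choose α : ℕ) : ℝ) *
                ((((reps π (vBH π (strip π S Y) H ∪ vBN π (strip π S Y) H)).card +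
                  (reps π (vDD π (strip π S Y) H)).card).choose (s - α) : ℕ) : ℝ)) := by
    intro Y hY α hα
    have hA : (0 : ℝ) ≤ (((reps π (vAA π (strip π S Y) H)).card.choose α : ℕ) : ℝ) := by positivity
    have hCh : (0 : ℝ) ≤ ((((reps π (vBH π (strip π S Y) H ∪ vBN π (strip π S Y) H)).card +
        (reps π (vDD π (strip π S Y) H)).card).choose (s - α) : ℕ) : ℝ) := by positivity
    have h4 := hypergeometric_absCoeffSum_le_four_pow
      (reps π (vBH π (strip π S Y) H ∪ vBN π (strip π S Y) H)).card
      (reps π (vDD π (strip π S Y) H)).card (s - α) m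
    by_cases hT : typ Y α
    · have hth := hypergeometric_absCoeffSum_le_of_le
        (reps π (vBH π (strip π S Y) H ∪ vBN π (strip π S Y) H)).card
        (reps π (vDD π (strip π S Y) H)).card (s - α) m hV₀ hm (htyp Y hY α hα hT)
      rw [if_pos hT, mul_zero, add_zero, mul_assoc]
      exact mul_le_mul_of_nonneg_left hth hA
    · rw [if_neg hT]
      calc _ ≤ (((reps π (vAA π (strip π S Y) H)).card.choose α : ℕ) : ℝ) *
            (((((reps π (vBH π (strip π S Y) H ∪ vBN π (strip π S Y) H)).card +
              (reps π (vDD π (strip π S Y) H)).card).choose (s - α) : ℕ) : ℝ) * (4 : ℝ) ^ m) :=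
            mul_le_mul_of_nonneg_left h4 hA
        _ ≤ _ := by nlinarith [mul_nonneg hA hCh, hB, mul_nonneg (mul_nonneg hA hCh) hB]
  -- sum the termwise bounds
  have hsum := sum_le_sum fun Y hY => sum_le_sum fun α hα => hterm Y hY α hα
  refine (mul_le_mul_of_nonneg_left hsum hκ).trans ?_
  simp only [sum_add_distrib, ← sum_mul, ← mul_sum]
  rw [← card_shellIn_eq_sum_halfSets_types hπ hπ' hS H c s, mul_add]
  -- `κ · (|Shell| · B₀) ≤ B₀` (with equality unless the shell is empty)
  have h1 : 1 / ((shellIn π S (c + 2 * s) c).card : ℝ) *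
      (((shellIn π S (c + 2 * s) c).card : ℝ) * (2 * Real.sqrt 192 * Real.sqrt (4 * m / V₀)) ^ (2 * m)) ≤
      (2 * Real.sqrt 192 * Real.sqrt (4 * m / V₀)) ^ (2 * m) := by
    by_cases h0 : ((shellIn π S (c + 2 * s) c).card : ℝ) = 0
    · rw [h0, zero_mul, mul_zero]; exact hB
    · rw [← mul_assoc, one_div_mul_cancel h0, one_mul]
  linarith [h1]

/-! ### §7 The atypical mass is a hypergeometric tail in the number of `HH` edges drawn

With the typical set `{α + r₀ ≤ s}` (at least `r₀` of the `s` full edges are NOT of type `HH`), the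
atypical mass of §6 is, half-set by half-set, the upper tail `P(α ≥ s+1−r₀)` of the hypergeometric
number `α` of `HH` edges among `s` edges drawn from the `N′ = |S|/2 − c` edges of the stripped ground
set, bounded by the factorial-moment bound of `RealRootedBernoulliSum` §5:
`μ(atypical) ≤ C(s,k)·C(a,k)/C(N′,k)`, `k = s+1−r₀`, `a` = number of `HH` edges of `S`. -/

/-- The three edge types partition a `π`-stable ground set: `2·(a′ + (b′ + d′)) = |S′|` with `a′, b′, d′`
the numbers of `HH`, mixed and `H̄H̄` EDGES (representative counts). [cite: Rothvoss2017, §2 (PDF p. 5)] -/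
theorem two_mul_typeReps_eq_card {S : Finset (Fin n)} (hS : ∀ v ∈ S, π v ∈ S) (H : Finset (Fin n)) :
    2 * ((reps π (vAA π S H)).card + ((reps π (vBH π S H ∪ vBN π S H)).card + (reps π (vDD π S H)).card)) =
      S.card := by
  rw [mul_add, mul_add, two_mul_card_reps hπ hπ' (vAA_stable hπ S H hS),
    two_mul_card_reps hπ hπ' (vB_stable hπ S H hS), two_mul_card_reps hπ hπ' (vDD_stable hπ S H hS),
    card_union_of_disjoint (disjoint_left.2 fun v hv hv' => (mem_vBN.1 hv').2.1 (mem_vBH.1 hv).2.1)]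
  have h1 := card_filter_add_card_filter_not (s := S) (fun v => v ∈ H)
  have h2 := card_filter_add_card_filter_not (s := S.filter fun v => v ∈ H) (fun v => π v ∈ H)
  have h3 := card_filter_add_card_filter_not (s := S.filter fun v => v ∉ H) (fun v => π v ∈ H)
  simp only [filter_filter] at h2 h3
  have eAA : (S.filter fun v => v ∈ H ∧ π v ∈ H) = vAA π S H := rfl
  have eBH : (S.filter fun v => v ∈ H ∧ ¬π v ∈ H) = vBH π S H := rfl
  have eBN : (S.filter fun v => v ∉ H ∧ π v ∈ H) = vBN π S H := rfl
  have eDD : (S.filter fun v => v ∉ H ∧ ¬π v ∈ H) = vDD π S H := rfl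
  rw [eAA, eBH] at h2
  rw [eBN, eDD] at h3
  omega

/-- For an admissible half-set `Y` at level `c`, the stripped ground set has `N′ = |S|/2 − c` edges:
`a_Y + (b_Y + d_Y) = |S|/2 − c`. [cite: Rothvoss2017, §2 (PDF p. 6)] -/
theorem typeReps_strip_eq {S : Finset (Fin n)} (hS : ∀ v ∈ S, π v ∈ S) (H : Finset (Fin n)) {c : ℕ}
    {Y : Finset (Fin n)} (hY : Y ∈ halfSets π S c) :
    (reps π (vAA π (strip π S Y) H)).card +
      ((reps π (vBH π (strip π S Y) H ∪ vBN π (strip π S Y) H)).card + (reps π (vDD π (strip π S Y) H)).card) =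
      S.card / 2 - c := by
  have h1 := two_mul_typeReps_eq_card hπ hπ' (strip_stable hπ hS (Y := Y)) H
  have h2 := card_strip hπ hS hY
  omega

omit hπ hπ' in
/-- The stripped ground set has at most as many `HH` edges as `S`: `a_Y ≤ a`.
[cite: Rothvoss2017, §2 (PDF p. 5)] -/
theorem reps_vAA_strip_le (S H Y : Finset (Fin n)) :
    (reps π (vAA π (strip π S Y) H)).card ≤ (reps π (vAA π S H)).card := by
  refine card_le_card fun v hv => ?_
  rw [mem_reps, mem_vAA] at hv ⊢
  obtain ⟨⟨hvS, hvH, hπv⟩, hlt⟩ := hv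
  exact ⟨⟨(mem_sdiff.1 (show v ∈ S \ (Y ∪ Y.image π) from hvS)).1, hvH, hπv⟩, hlt⟩

/-- **The atypical mass, half-set by half-set**: for `1 ≤ r₀`, `k = s + 1 − r₀` and an admissible `Y`,
`Σ_{α ≤ s, α + r₀ > s} C(a_Y,α)·C(b_Y+d_Y,s−α) ≤ C(N′,s)·C(s,k)·C(a_Y,k)/C(N′,k)` (`N′ = |S|/2 − c`).
[cite: LehmannRomano2005, Example 3.4.1] [cite: Rothvoss2017, §2 (PDF p. 6)] -/
theorem atypical_sum_le {S : Finset (Fin n)} (hS : ∀ v ∈ S, π v ∈ S) (H : Finset (Fin n))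
    {c s r₀ : ℕ} (hr₀ : 1 ≤ r₀) {Y : Finset (Fin n)} (hY : Y ∈ halfSets π S c) :
    (∑ α ∈ range (s + 1),
        if α + r₀ ≤ s then (0 : ℝ) else
          (((reps π (vAA π (strip π S Y) H)).card.choose α : ℕ) : ℝ) *
            ((((reps π (vBH π (strip π S Y) H ∪ vBN π (strip π S Y) H)).card +
              (reps π (vDD π (strip π S Y) H)).card).choose (s - α) : ℕ) : ℝ)) ≤
      (((S.card / 2 - c).choose s : ℕ) : ℝ) * ((s.choose (s + 1 - r₀) : ℝ) *
        (((reps π (vAA π (strip π S Y) H)).card.choose (s + 1 - r₀) : ℕ) : ℝ) /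
          (((S.card / 2 - c).choose (s + 1 - r₀) : ℕ) : ℝ)) := by
  have hN := typeReps_strip_eq hπ hπ' hS H hY
  -- abbreviate the type counts of the stripped ground set
  generalize ha : (reps π (vAA π (strip π S Y) H)).card = a at hN ⊢
  generalize hM : (reps π (vBH π (strip π S Y) H ∪ vBN π (strip π S Y) H)).card +
    (reps π (vDD π (strip π S Y) H)).card = M at hN ⊢
  generalize hk : s + 1 - r₀ = k
  have hks : k ≤ s := by omega
  -- the `if` selects exactly `α ≥ k`
  have hsel : ∑ α ∈ range (s + 1), (if α + r₀ ≤ s then (0 : ℝ) else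
      ((a.choose α : ℕ) : ℝ) * ((M.choose (s - α) : ℕ) : ℝ)) =
      ((∑ α ∈ Ico k (s + 1), a.choose α * M.choose (s - α) : ℕ) : ℝ) := by
    rw [Nat.cast_sum, ← sum_range_add_sum_Ico _ (show k ≤ s + 1 by omega)]
    rw [sum_eq_zero (fun α hα => by rw [if_pos (by have := mem_range.1 hα; omega)]), zero_add]
    refine sum_congr rfl fun α hα => ?_
    rw [if_neg (by have := (mem_Ico.1 hα).1; omega), Nat.cast_mul]
  rw [hsel]
  have htail := sum_Ico_choose_mul_choose_le a M s k hks
  rcases Nat.lt_or_ge a k with hak | hak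
  · -- no `k` edges of type `HH` at all
    have h0 : ∑ α ∈ Ico k (s + 1), a.choose α * M.choose (s - α) = 0 :=
      sum_eq_zero fun α hα => by rw [Nat.choose_eq_zero_of_lt (by have := (mem_Ico.1 hα).1; omega), zero_mul]
    rw [h0, Nat.choose_eq_zero_of_lt hak]
    simp
  · have hid := choose_mul_choose_sub_mul a M s k hks hak
    rw [← hN] at *
    have hCk : (0 : ℝ) < (((a + M).choose k : ℕ) : ℝ) := by exact_mod_cast Nat.choose_pos (by omega)
    rw [mul_div_assoc', le_div_iff₀ hCk]
    have h' : ((∑ α ∈ Ico k (s + 1), a.choose α * M.choose (s - α) : ℕ) : ℝ) * (((a + M).choose k : ℕ) : ℝ) ≤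
        ((a.choose k * (a - k + M).choose (s - k) * (a + M).choose k : ℕ) : ℝ) := by
      rw [Nat.cast_mul (a.choose k * _)]
      exact mul_le_mul_of_nonneg_right (by exact_mod_cast htail) (by positivity)
    rw [hid] at h'
    push_cast at h' ⊢
    linarith

/-- **The `x`-smoothness of a shell law with the hypergeometric tail priced in.** For a `π`-stable ground
set `S` (with `a` edges of type `HH` and `N′ = |S|/2 − c`), block `H`, level `c`, `s` full edges, every
`m`, every finite window, every `V₀ > 0` with `2m − 1 ≤ 2V₀` and every `r₀ ≥ 1` such that the
hypergeometric components with at least `r₀` non-`HH` draws have variance `≥ V₀`: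
`Σ_{x ∈ win} |(∇²)^m law_S(c+2s,·)(c)(x)| ≤ (2√192·√(4m/V₀))^{2m} + 4^m · C(s,k)·C(a,k)/C(N′,k)`, `k = s+1−r₀`
(and `C(a,k)/C(N′,k) ≤ (a/N′)^k`, `RealRootedBernoulliSum.choose_mul_pow_le`).
[cite: RollinRoss2010, Lemma 3.3] [cite: LehmannRomano2005, Example 3.4.1] [cite: Rothvoss2017, §2 (PDF p. 6)] -/
theorem sum_abs_nab2_iter_shellLaw_le_tail {S : Finset (Fin n)} (hS : ∀ v ∈ S, π v ∈ S)
    (H : Finset (Fin n)) (c s m r₀ : ℕ) (hr₀ : 1 ≤ r₀) (win : Finset ℤ) {V₀ : ℝ} (hV₀ : 0 < V₀)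
    (hm : (2 * m : ℝ) - 1 ≤ 2 * V₀)
    (hV : ∀ Y ∈ halfSets π S c, ∀ α ∈ range (s + 1), α + r₀ ≤ s →
      V₀ ≤ ((s - α : ℕ) : ℝ) * (reps π (vBH π (strip π S Y) H ∪ vBN π (strip π S Y) H)).card *
          (reps π (vDD π (strip π S Y) H)).card *
          (((reps π (vBH π (strip π S Y) H ∪ vBN π (strip π S Y) H)).card : ℝ) +
            (reps π (vDD π (strip π S Y) H)).card - ((s - α : ℕ) : ℝ)) /
        ((((reps π (vBH π (strip π S Y) H ∪ vBN π (strip π S Y) H)).card : ℝ) +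
            (reps π (vDD π (strip π S Y) H)).card) ^ 2 *
          (((reps π (vBH π (strip π S Y) H ∪ vBN π (strip π S Y) H)).card : ℝ) +
            (reps π (vDD π (strip π S Y) H)).card - 1))) :
    ∑ x ∈ win, |nab2^[m] (fun c' x => shellLaw π S H (c + 2 * s) c' x : Profile) c x| ≤
      (2 * Real.sqrt 192 * Real.sqrt (4 * m / V₀)) ^ (2 * m) +
        (4 : ℝ) ^ m * ((s.choose (s + 1 - r₀) : ℝ) *
          (((reps π (vAA π S H)).card.choose (s + 1 - r₀) : ℕ) : ℝ) /
            (((S.card / 2 - c).choose (s + 1 - r₀) : ℕ) : ℝ)) := by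
  classical
  refine (sum_abs_nab2_iter_shellLaw_le_threshold hπ hπ' hS H c s m win hV₀ hm (fun Y α => α + r₀ ≤ s)
    (fun Y hY α hα hT => hV Y hY α hα hT)).trans ?_
  have h4 : (0 : ℝ) ≤ (4 : ℝ) ^ m := by positivity
  refine add_le_add le_rfl (mul_le_mul_of_nonneg_left ?_ h4)
  -- per half-set tail bound, then `a_Y ≤ a`, then the normalisation
  have hκ : 0 ≤ 1 / ((shellIn π S (c + 2 * s) c).card : ℝ) := by positivity
  set B : ℝ := (s.choose (s + 1 - r₀) : ℝ) * (((reps π (vAA π S H)).card.choose (s + 1 - r₀) : ℕ) : ℝ) /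
    (((S.card / 2 - c).choose (s + 1 - r₀) : ℕ) : ℝ) with hB
  have hB0 : 0 ≤ B := by positivity
  have hper : ∀ Y ∈ halfSets π S c,
      (∑ α ∈ range (s + 1),
        if α + r₀ ≤ s then (0 : ℝ) else
          (((reps π (vAA π (strip π S Y) H)).card.choose α : ℕ) : ℝ) *
            ((((reps π (vBH π (strip π S Y) H ∪ vBN π (strip π S Y) H)).card +
              (reps π (vDD π (strip π S Y) H)).card).choose (s - α) : ℕ) : ℝ)) ≤
        (((S.card / 2 - c).choose s : ℕ) : ℝ) * B := by
    intro Y hY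
    refine (atypical_sum_le hπ hπ' hS H hr₀ hY).trans (mul_le_mul_of_nonneg_left ?_ (by positivity))
    rw [hB]
    refine div_le_div_of_nonneg_right (mul_le_mul_of_nonneg_left ?_ (by positivity)) (by positivity)
    exact_mod_cast Nat.choose_le_choose _ (reps_vAA_strip_le S H Y)
  -- the shell size: `|Shell| = Σ_Y C(N′, s)`
  have hcard : ((shellIn π S (c + 2 * s) c).card : ℝ) =
      ∑ Y ∈ halfSets π S c, (((S.card / 2 - c).choose s : ℕ) : ℝ) := by
    rw [card_shellIn_eq_sum_halfSets_types hπ hπ' hS H c s]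
    refine sum_congr rfl fun Y hY => ?_
    rw [← typeReps_strip_eq hπ hπ' hS H hY, Nat.add_choose_eq,
      Finset.Nat.sum_antidiagonal_eq_sum_range_succ
        (fun i j => (reps π (vAA π (strip π S Y) H)).card.choose i *
          ((reps π (vBH π (strip π S Y) H ∪ vBN π (strip π S Y) H)).card +
            (reps π (vDD π (strip π S Y) H)).card).choose j) s]
    push_cast
    rfl
  calc 1 / ((shellIn π S (c + 2 * s) c).card : ℝ) *
        ∑ Y ∈ halfSets π S c, ∑ α ∈ range (s + 1),
          (if α + r₀ ≤ s then (0 : ℝ) else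
            (((reps π (vAA π (strip π S Y) H)).card.choose α : ℕ) : ℝ) *
              ((((reps π (vBH π (strip π S Y) H ∪ vBN π (strip π S Y) H)).card +
                (reps π (vDD π (strip π S Y) H)).card).choose (s - α) : ℕ) : ℝ))
      ≤ 1 / ((shellIn π S (c + 2 * s) c).card : ℝ) *
          ∑ Y ∈ halfSets π S c, (((S.card / 2 - c).choose s : ℕ) : ℝ) * B :=
        mul_le_mul_of_nonneg_left (sum_le_sum hper) hκ
    _ = 1 / ((shellIn π S (c + 2 * s) c).card : ℝ) * ((shellIn π S (c + 2 * s) c).card : ℝ) * B := by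
        rw [← sum_mul, ← hcard, mul_assoc]
    _ ≤ B := by
        by_cases h0 : ((shellIn π S (c + 2 * s) c).card : ℝ) = 0
        · rw [h0, mul_zero, zero_mul]; exact hB0
        · rw [one_div_mul_cancel h0, one_mul]

/-! ### §8 Transport: shell counts, shell sizes and shell laws depend on the ground set only through
its `H`-type (from the edge-product formula `Ψ_S = A^a B^b D^d` of `ShellLawEdgeProduct.lean`) -/

/-- **Shell counts depend only on the type**: two `π`-stable ground sets with the same numbers of `HH`,
mixed and `H̄H̄` edges have the same `Sh(t,c;x)` for all `t, c, x`. [cite: Rothvoss2017, §2 (PDF p. 6)] -/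
theorem shellCount_eq_of_type_eq {S₁ S₂ : Finset (Fin n)} (hS₁ : ∀ v ∈ S₁, π v ∈ S₁)
    (hS₂ : ∀ v ∈ S₂, π v ∈ S₂) (H : Finset (Fin n))
    (ha : (reps π (vAA π S₁ H)).card = (reps π (vAA π S₂ H)).card)
    (hb : (reps π (vBH π S₁ H ∪ vBN π S₁ H)).card = (reps π (vBH π S₂ H ∪ vBN π S₂ H)).card)
    (hd : (reps π (vDD π S₁ H)).card = (reps π (vDD π S₂ H)).card) (t c : ℕ) (x : ℤ) :
    shellCount π S₁ H t c x = shellCount π S₂ H t c x := by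
  rcases lt_or_ge x 0 with hx | hx
  · rw [shellCount_eq_zero_of_neg _ _ _ _ hx, shellCount_eq_zero_of_neg _ _ _ _ hx]
  · obtain ⟨k, rfl⟩ := Int.eq_ofNat_of_zero_le hx
    rw [← coeff_shellGen S₁ H t c k, ← coeff_shellGen S₂ H t c k,
      shellGen_eq_of_type_eq hπ hπ' hS₁ hS₂ H ha hb hd t c]

/-- **Shell sizes depend only on the type.** [cite: Rothvoss2017, §2 (PDF p. 6)] -/
theorem card_shellIn_eq_of_type_eq {S₁ S₂ : Finset (Fin n)} (hS₁ : ∀ v ∈ S₁, π v ∈ S₁)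
    (hS₂ : ∀ v ∈ S₂, π v ∈ S₂) (H : Finset (Fin n))
    (ha : (reps π (vAA π S₁ H)).card = (reps π (vAA π S₂ H)).card)
    (hb : (reps π (vBH π S₁ H ∪ vBN π S₁ H)).card = (reps π (vBH π S₂ H ∪ vBN π S₂ H)).card)
    (hd : (reps π (vDD π S₁ H)).card = (reps π (vDD π S₂ H)).card) (t c : ℕ) :
    (shellIn π S₁ t c).card = (shellIn π S₂ t c).card := by
  have h := congrArg (Polynomial.eval (1 : ℝ)) (shellGen_eq_of_type_eq hπ hπ' hS₁ hS₂ H ha hb hd t c)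
  simp only [eval_one_shellGen] at h
  exact_mod_cast h

/-- **Shell laws depend only on the type** (and so do all their iterated differences: the profile
`c ↦ x ↦ law_S(t,c;x)` is the same function). [cite: Rothvoss2017, §2 (PDF p. 6)] -/
theorem shellLaw_eq_of_type_eq {S₁ S₂ : Finset (Fin n)} (hS₁ : ∀ v ∈ S₁, π v ∈ S₁)
    (hS₂ : ∀ v ∈ S₂, π v ∈ S₂) (H : Finset (Fin n))
    (ha : (reps π (vAA π S₁ H)).card = (reps π (vAA π S₂ H)).card)
    (hb : (reps π (vBH π S₁ H ∪ vBN π S₁ H)).card = (reps π (vBH π S₂ H ∪ vBN π S₂ H)).card)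
    (hd : (reps π (vDD π S₁ H)).card = (reps π (vDD π S₂ H)).card) (t : ℕ) :
    (fun c x => shellLaw π S₁ H t c x : Profile) = fun c x => shellLaw π S₂ H t c x := by
  funext c x
  rw [shellLaw, shellLaw, shellCount_eq_of_type_eq hπ hπ' hS₁ hS₂ H ha hb hd,
    card_shellIn_eq_of_type_eq hπ hπ' hS₁ hS₂ H ha hb hd]

end GenPoly

end ShellStep

end Literature.Combinatorics.Optimization

end
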